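import Summits.HubbardSuperconductivity.HubbardSuperconductivity.Theorems.AnisotropyChordTransferFibre3Hole2Quarter

/-!
# Route `AnisotropyChord` / H0 rotor rung: ★ HOLE₂(.75) AT `L = 14` — `TwoHoleGap 14 (3/4·eps1 14)`

The one-body spectral input of the GM₃ assembly `gm3_of_hole2` (p1 g23) at side length `L = 14`: the Neumann gap of the rate-½ walk
on the `14 × 14` torus with ANY two vertices deleted is at least `¾ε₁(14)`.  KERNEL CERTIFICATE, ZERO DATA: the quarter-table interval
Birman–Schwinger checker `Hole2.checkRepsQ` (`…Fibre3Hole2Quarter`: separable Green table on `0 ≤ r₁,r₂ ≤ L/2`, fixed-point Gauss–Jordan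
charge map, exact Schur positivity test) accepts the 35 `D₄`-classes of separations `0 ≤ y ≤ x ≤ 7` (one `decide +kernel`), and the classes
cover every nonzero separation (`decide +kernel`); soundness is `Hole2.twoHoleGap_of_checkRepsQ` (resting on p2's PROP BS `…Fibre3TwoHoleBS`
and p1's reductions `…Fibre3TwoHoleGapReduce`).  Python mirror (prover's folder `scratch/fixcert.py`): all classes pass for every
`9 ≤ L ≤ 32`; the same test fails just above the true gap (`L = 8`: `.737ε₁`; `L = 9`: `.774ε₁`).
Prover seat `hubbard-h0-rotor-p3` g3; helper for stmt-HubbardSuperconductivity-19089 (`--supports`, helper class).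
WHAT THIS IS NOT: nothing here proves superconductivity in the Hubbard model (rotor TARGET as worded stays FALSE, g15 verdict); this
discharges, at ONE side length, ONE hypothesis (HOLE₂(.75)) of ONE conditional reduction (rung 19089); the three β-free cruxes, `mHole ≥ 0`
and the side condition of `gm3_of_hole2` are untouched. Tree imports only; no sorry, no axioms, no `native_decide`.
-/

set_option linter.dupNamespace false
set_option autoImplicit false

namespace Summit.HubbardSuperconductivity.HubbardSuperconductivity.Theorems.AnisotropyChord.Transfer.Fibre3

namespace Hole2

/-- the 35 `D₄`-representatives of the nonzero separations of the `14 × 14` torus. [folklore] -/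
def reps14 : List (ℕ × ℕ) := [(1, 0), (1, 1), (2, 0), (2, 1), (2, 2), (3, 0), (3, 1), (3, 2), (3, 3), (4, 0), (4, 1), (4, 2), (4, 3), (4, 4), (5, 0), (5, 1), (5, 2), (5, 3), (5, 4), (5, 5), (6, 0), (6, 1), (6, 2), (6, 3), (6, 4), (6, 5), (6, 6), (7, 0), (7, 1), (7, 2), (7, 3), (7, 4), (7, 5), (7, 6), (7, 7)]

/-- kernel fact: every representative passes the quarter-table interval Birman–Schwinger test at `g_14 ≥ ¾ε₁(14)`. [folklore] -/
theorem checkRepsQ_14 : checkRepsQ 14 reps14 = true := by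
  decide +kernel

/-- the representatives meet the `D₄`-orbit of every nonzero separation (finite check). [folklore] -/
theorem cover_14 : ∀ z : Tor 14, z ≠ 0 → ∃ s ∈ (reps14.map fun ab => sT 14 ab.1 ab.2).toFinset, s ∈ d4Orbit 14 z := by
  decide +kernel

/-- ★★★ HOLE₂(.75) AT `L = 14`: `TwoHoleGap 14 (3/4 * eps1 14)`, the spectral hypothesis of `gm3_of_hole2` at `L = 14`. [folklore] -/
theorem twoHoleGap_fourteen : TwoHoleGap 14 (3 / 4 * eps1 14) :=
  twoHoleGap_of_checkRepsQ 14 reps14 checkRepsQ_14 cover_14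

end Hole2

end Summit.HubbardSuperconductivity.HubbardSuperconductivity.Theorems.AnisotropyChord.Transfer.Fibre3
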